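import Summits.RiemannHypothesis.RiemannHypothesis.Theorems.LiCoefficientsDefs
import Literature.NumberTheory.LFunctions.ZetaZeroReciprocalSum
import HarnessLib

/-!
# RiemannHypothesis / Nyman–Beurling — the dilate zero sum at `n = 1`: `S(1) = Σ_ρ m_ρ/(ρ(1−ρ)) = 2 + γ − log 4π`
(first conjunct of the theory target `NbDilateZeroSumExplicit` (T7), RH-FREE, DISCHARGED)

Column LI/NB of the RH ladder, rung L-P(P2), PROOF-OF-DATA for cell `pub/rh-li` [rh-li-eng-3 g4].  The theory memo
`theory/TARGETS.md` §8.2 (T7) types `NbDilateZeroSumExplicit`: the dilate zero sums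
`S(n) = nbDilateZeroSum n = Σ_ρ m_ρ n^{−ρ}/(ρ(1−ρ))` (over the non-trivial zeros, with multiplicity) are PRIME-SIDE numbers;
its first conjunct is `S(1) = 2 + γ − log 4π`.  That conjunct is exactly the absolutely convergent zero sum
`Σ_ρ m_ρ/(ρ(1−ρ)) = β` of the tree (`Literature.NumberTheory.LFunctions.hasSum_zeroOrder_div_mul_one_sub`, Nicolas's
`β = 2 + γ − log π − 2 log 2`), since `1^{−ρ} = 1`:

* `nbDilateZeroSum_one : nbDilateZeroSum 1 = 2 + γ − log 4π`.

The second conjunct (`n ≥ 2`: the integrated von Mangoldt explicit formula) is NOT proved here.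
RH-FREE [rh-li-eng-3 g4]: a re-indexing of a classical zero-sum constant; nothing here bears on the truth of RH.
-/

noncomputable section

-- D-0017: `Summit.<S>.<S>.…` is the designed namespace of a single-problem summit.
set_option linter.dupNamespace false

namespace Summit.RiemannHypothesis.RiemannHypothesis.Theorems.NbTheory

open Literature.NumberTheory.LFunctions

/-- **`S(1) = Σ_ρ m_ρ/(ρ(1−ρ)) = 2 + γ − log 4π` (RH-FREE):** the `n = 1` dilate zero sum is Nicolas's constant `β`
(the first conjunct of the theory target `NbDilateZeroSumExplicit`). -/
theorem nbDilateZeroSum_one :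
    nbDilateZeroSum 1 = ((2 + Real.eulerMascheroniConstant - Real.log (4 * Real.pi) : ℝ) : ℂ) := by
  have h : HasSum (fun ρ : ZetaZeros.riemannZetaNontrivialZeros ↦
      (riemannZetaZeroOrder (ρ : ℂ) : ℂ) / ((ρ : ℂ) * (1 - ρ))) (nicolasBeta : ℂ) :=
    hasSum_zeroOrder_div_mul_one_sub
  have hβ : nicolasBeta = 2 + Real.eulerMascheroniConstant - Real.log (4 * Real.pi) := by
    unfold nicolasBeta
    rw [show (4 : ℝ) * Real.pi = 2 ^ 2 * Real.pi by norm_num, Real.log_mul (by positivity) Real.pi_pos.ne',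
      Real.log_pow]
    push_cast
    ring
  unfold nbDilateZeroSum
  rw [← hβ, ← h.tsum_eq]
  refine tsum_congr fun ρ ↦ ?_
  rw [Nat.cast_one, Complex.one_cpow, mul_one]

end Summit.RiemannHypothesis.RiemannHypothesis.Theorems.NbTheory

end
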